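/-
Copyright: statement-level skeleton of a published paper (lit-balaban cell, Phase-2 proof seat p13, gen 6). No proof
claims beyond what the kernel checks below.
-/
import Mathlib.Analysis.SpecialFunctions.SmoothTransition
import Literature.MathematicalPhysics.QuantumFieldTheory.BalabanImbrieJaffe1984to88.BIJ88Sect2Statements

/-!
# `BalabanImbrieJaffe1984to88.BIJ88Cutoffs21` — T. Bałaban, J. Imbrie, A. Jaffe, *Effective action and cluster
properties of the abelian Higgs model*, Commun. Math. Phys. **114** (1988) 257–315 [BalabanImbrieJaffe1988], §2:
**the smooth cutoffs `ζ_k` (2.1) p. 260, `ζ′_k` (2.24) p. 262, `ζ″_k` (2.29) p. 263 CONSTRUCTED** — one `C^∞`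
profile of the distance with the two printed thresholds, inhabiting r18's typed predicates `Zeta21`, `Zeta224`,
`Zeta229` (`IsCutoff`), with values in `[0, 1]` (the side hypothesis of every downstream use).

statement-level skeleton of published theorems with citation tags; proofs where landed; nothing here is a claim
about the Yang–Mills mass gap

PDF held: `paper:balaban1988-cmp114-bij-abelian-higgs-effective-action` (journal page = PDF page + 256; pp. 260,
262, 263 read with `lit read … --pages 4,6,7`).

CITATION HEADER (lean-in-tree rule).  lit-balaban cell (HOME `run/shared/lean/pub/lit-balaban/`), Phase 2, seat p13
gen 6 (unit `lit-balaban-p13-g6`); rows **C2.Eq2.1**, **C2.Eq2.24**, **C2.Eq2.29** (DEF) of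
`HOME/lit-balaban-r18/ROWS-C2.md` (owner r18, referee ref-5; typed `BIJ88Sect2Statements.Zeta21` / `Zeta224` /
`Zeta229` over `IsCutoff`, p239939).  The hypotheses `IsCutoff dist ζ R₁ R₀` and `0 ≤ ζ ≤ 1` of
`BIJ88Close218Proof.close_loc_of_decayFar` (p02 g3, p248140: (2.26)), `BIJ88OpDecay230Proof.abs_loc_sub_le` /
`opClose231_loc` (p02 g3, p248817: (2.31)) are DISCHARGED here by one concrete family.  Files USED BY NAME, nothing
restated: `…BIJ88Sect2Statements` (`IsCutoff`, `Zeta21`, `Zeta224`, `Zeta229`, `loc`); Mathlib's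
`Real.smoothTransition` (the standard `C^∞` step: `0` on `(−∞, 0]`, `1` on `[1, ∞)`).

## The print (verbatim)

p. 260: *"Construct a translation invariant localization function ζ_k such that ζ_k(b, b′) = 0, if dist(b, b′) ≧
⅛r(e_k), 1, if dist(b, b′) ≦ (1/16)r(e_k), (2.1) and such that ζ_k is a smooth function of b."*  p. 262: *"The
localized version of C_k is defined using another smooth cutoff: ζ′_k(x, b′) = 1, for dist(x, b′) ≦ ¼r(e_k), 0, for
dist(x, b′) ≧ ½r(e_k). (2.24)"*  p. 263: *"where ζ″_k(x₁, x₂) is a smooth function of x₁ − x₂, ζ″_k(x₁, x₂) = 0, if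
|x₁ − x₂| ≧ (1/4L) r(e_{k−1}), 1, if |x₁ − x₂| ≦ (1/8L) r(e_{k−1}). (2.29)"*

## What is constructed and proved

For thresholds `R₁ < R₀` and any distance-like function `dist : α → β → ℝ`, the cutoff
`cutoff R₁ R₀ dist a b = σ((R₀ − dist a b)/(R₀ − R₁))` with `σ = Real.smoothTransition` (`C^∞`, `σ = 0` on
`(−∞,0]`, `σ = 1` on `[1,∞)`): `= 1` where `dist ≤ R₁`, `= 0` where `dist ≥ R₀` (`isCutoff_cutoff`), values in
`[0,1]` (`cutoff_nonneg`, `cutoff_le_one`, `cutoff_mem_Icc`), antitone in the distance (`cutoff_anti`), a `C^∞`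
function OF THE DISTANCE (`contDiff_cutoffProfile`: the print's *"smooth"*, here in the distance variable), and
*"translation invariant"* whenever `dist` is (`cutoff_invariant`); the three printed instances `Zeta21` (thresholds
`r(e_k)/16 < r(e_k)/8`), `Zeta224` (`r(e_k)/4 < r(e_k)/2`), `Zeta229` (`r(e_{k−1})/(8L) < r(e_{k−1})/(4L)`) are
inhabited for `r(e_k) > 0`, `L > 0` (`zeta21_cutoff`, `zeta224_cutoff`, `zeta229_cutoff`).  HONEST SCOPE: the print's
"smooth function of b" (of the lattice point) is delivered as smoothness in `dist(b, b′)`; composing with a smooth /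
Lipschitz distance is the user's step.  No `sorry`; no new `Prop` fact.
-/

namespace Literature.MathematicalPhysics.QuantumFieldTheory.BalabanImbrieJaffe1984to88.BIJ88Cutoffs21

open Literature.MathematicalPhysics.QuantumFieldTheory.BalabanImbrieJaffe1984to88
open BIJ88Sect2Statements

variable {α β : Type*}

/-! ## §1 The profile and the cutoff -/

/-- the `C^∞` profile of the distance: `t ↦ σ((R₀ − t)/(R₀ − R₁))`, `σ` = `Real.smoothTransition`.
[cite: BalabanImbrieJaffe1988, (2.1) p.260] -/
noncomputable def cutoffProfile (R₁ R₀ t : ℝ) : ℝ := Real.smoothTransition ((R₀ - t) / (R₀ - R₁))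

/-- **the cutoff** `ζ(a, b) = σ((R₀ − dist(a,b))/(R₀ − R₁))`: `1` within `R₁`, `0` beyond `R₀`, smooth in between —
the common shape of `ζ_k` (2.1), `ζ′_k` (2.24), `ζ″_k` (2.29). [cite: BalabanImbrieJaffe1988, (2.1) p.260] -/
noncomputable def cutoff (R₁ R₀ : ℝ) (dist : α → β → ℝ) : α → β → ℝ :=
  fun a b => cutoffProfile R₁ R₀ (dist a b)

/-- unfolding the cutoff. [cite: BalabanImbrieJaffe1988, (2.1) p.260] -/
theorem cutoff_apply (R₁ R₀ : ℝ) (dist : α → β → ℝ) (a : α) (b : β) :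
    cutoff R₁ R₀ dist a b = Real.smoothTransition ((R₀ - dist a b) / (R₀ - R₁)) := rfl

/-! ## §2 The two printed thresholds: `IsCutoff` -/

/-- the profile is `1` below the inner threshold. [cite: BalabanImbrieJaffe1988, (2.1) p.260] -/
theorem cutoffProfile_eq_one {R₁ R₀ t : ℝ} (hR : R₁ < R₀) (ht : t ≤ R₁) : cutoffProfile R₁ R₀ t = 1 := by
  unfold cutoffProfile
  apply Real.smoothTransition.one_of_one_le
  rw [le_div_iff₀ (sub_pos.mpr hR)]
  linarith

/-- the profile is `0` above the outer threshold. [cite: BalabanImbrieJaffe1988, (2.1) p.260] -/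
theorem cutoffProfile_eq_zero {R₁ R₀ t : ℝ} (hR : R₁ < R₀) (ht : R₀ ≤ t) : cutoffProfile R₁ R₀ t = 0 := by
  unfold cutoffProfile
  apply Real.smoothTransition.zero_of_nonpos
  exact div_nonpos_of_nonpos_of_nonneg (by linarith) (sub_pos.mpr hR).le

/-- **the printed two-threshold shape**: `ζ = 1` for `dist ≤ R₁`, `ζ = 0` for `dist ≥ R₀` — r18's `IsCutoff` INHABITED
for every `R₁ < R₀`. [cite: BalabanImbrieJaffe1988, (2.1) p.260] -/
theorem isCutoff_cutoff {R₁ R₀ : ℝ} (hR : R₁ < R₀) (dist : α → β → ℝ) : IsCutoff dist (cutoff R₁ R₀ dist) R₁ R₀ :=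
  ⟨fun _ _ h => cutoffProfile_eq_one hR h, fun _ _ h => cutoffProfile_eq_zero hR h⟩

/-! ## §3 Values in `[0, 1]`, monotonicity -/

/-- `0 ≤ ζ`. [cite: BalabanImbrieJaffe1988, (2.1) p.260] -/
theorem cutoff_nonneg (R₁ R₀ : ℝ) (dist : α → β → ℝ) (a : α) (b : β) : 0 ≤ cutoff R₁ R₀ dist a b :=
  Real.smoothTransition.nonneg _

/-- `ζ ≤ 1`. [cite: BalabanImbrieJaffe1988, (2.1) p.260] -/
theorem cutoff_le_one (R₁ R₀ : ℝ) (dist : α → β → ℝ) (a : α) (b : β) : cutoff R₁ R₀ dist a b ≤ 1 :=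
  Real.smoothTransition.le_one _

/-- `0 ≤ ζ ≤ 1` in the paired form used downstream (`BIJ88Close218Proof`, `BIJ88OpDecay230Proof`).
[cite: BalabanImbrieJaffe1988, (2.1) p.260] -/
theorem cutoff_mem_Icc (R₁ R₀ : ℝ) (dist : α → β → ℝ) :
    ∀ a b, 0 ≤ cutoff R₁ R₀ dist a b ∧ cutoff R₁ R₀ dist a b ≤ 1 :=
  fun a b => ⟨cutoff_nonneg R₁ R₀ dist a b, cutoff_le_one R₁ R₀ dist a b⟩

/-- the profile is antitone in the distance (for `R₁ < R₀`). [cite: BalabanImbrieJaffe1988, (2.1) p.260] -/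
theorem cutoffProfile_anti {R₁ R₀ : ℝ} (hR : R₁ < R₀) : Antitone (cutoffProfile R₁ R₀) := by
  intro s t hst
  unfold cutoffProfile
  apply Real.smoothTransition.monotone
  exact div_le_div_of_nonneg_right (by linarith) (sub_pos.mpr hR).le

/-- the cutoff decreases with the distance: `dist(a,b) ≤ dist(a′,b′) ⇒ ζ(a′,b′) ≤ ζ(a,b)`. [cite: BalabanImbrieJaffe1988, (2.1) p.260] -/
theorem cutoff_anti {R₁ R₀ : ℝ} (hR : R₁ < R₀) (dist : α → β → ℝ) {a a' : α} {b b' : β}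
    (h : dist a b ≤ dist a' b') : cutoff R₁ R₀ dist a' b' ≤ cutoff R₁ R₀ dist a b :=
  cutoffProfile_anti hR h

/-! ## §4 *"smooth"* and *"translation invariant"* -/

/-- **the profile is `C^∞` in the distance variable** (*"ζ_k is a smooth function of b"*, *"another smooth
cutoff"*, *"a smooth function of x₁ − x₂"*: smoothness delivered in `dist`). [cite: BalabanImbrieJaffe1988, (2.1) p.260] -/
theorem contDiff_cutoffProfile (R₁ R₀ : ℝ) {n : ℕ∞} : ContDiff ℝ n (cutoffProfile R₁ R₀) := by
  unfold cutoffProfile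
  exact Real.smoothTransition.contDiff.comp ((contDiff_const.sub contDiff_id).div_const _)

/-- the profile is continuous in the distance. [cite: BalabanImbrieJaffe1988, (2.1) p.260] -/
theorem continuous_cutoffProfile (R₁ R₀ : ℝ) : Continuous (cutoffProfile R₁ R₀) :=
  (contDiff_cutoffProfile R₁ R₀ (n := 0)).continuous

/-- **"translation invariant"**: the cutoff is invariant under every pair of maps preserving `dist` (e.g. the
lattice translations of `T_η`, `T₁^{(k)}`). [cite: BalabanImbrieJaffe1988, (2.1) p.260] -/
theorem cutoff_invariant (R₁ R₀ : ℝ) (dist : α → β → ℝ) (τ : α → α) (τ' : β → β)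
    (hτ : ∀ a b, dist (τ a) (τ' b) = dist a b) (a : α) (b : β) :
    cutoff R₁ R₀ dist (τ a) (τ' b) = cutoff R₁ R₀ dist a b := by
  rw [cutoff_apply, cutoff_apply, hτ]

/-- the cutoff depends on `(a, b)` only through `dist(a, b)` (*"a smooth function of x₁ − x₂"* when `dist` is).
[cite: BalabanImbrieJaffe1988, (2.29) p.263] -/
theorem cutoff_congr_dist (R₁ R₀ : ℝ) (dist : α → β → ℝ) {a a' : α} {b b' : β} (h : dist a b = dist a' b') :
    cutoff R₁ R₀ dist a b = cutoff R₁ R₀ dist a' b' := by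
  rw [cutoff_apply, cutoff_apply, h]

/-! ## §5 The three printed cutoffs inhabited -/

/-- **(2.1) CONSTRUCTED**: `ζ_k := cutoff (r(e_k)/16) (r(e_k)/8) dist` satisfies `Zeta21` for `r(e_k) > 0`.
[cite: BalabanImbrieJaffe1988, (2.1) p.260] -/
theorem zeta21_cutoff {rek : ℝ} (hr : 0 < rek) (dist : α → β → ℝ) :
    Zeta21 dist rek (cutoff (rek / 16) (rek / 8) dist) :=
  isCutoff_cutoff (by linarith) dist

/-- **(2.24) CONSTRUCTED**: `ζ′_k := cutoff (r(e_k)/4) (r(e_k)/2) dist` satisfies `Zeta224` for `r(e_k) > 0`.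
[cite: BalabanImbrieJaffe1988, (2.24) p.262] -/
theorem zeta224_cutoff {rek : ℝ} (hr : 0 < rek) (dist : α → β → ℝ) :
    Zeta224 dist rek (cutoff (rek / 4) (rek / 2) dist) :=
  isCutoff_cutoff (by linarith) dist

/-- **(2.29) CONSTRUCTED**: `ζ″_k := cutoff (r(e_{k−1})/(8L)) (r(e_{k−1})/(4L)) dist` satisfies `Zeta229` for
`r(e_{k−1}) > 0`, `L > 0`. [cite: BalabanImbrieJaffe1988, (2.29) p.263] -/
theorem zeta229_cutoff {L rekm1 : ℝ} (hL : 0 < L) (hr : 0 < rekm1) (dist : α → α → ℝ) :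
    Zeta229 dist L rekm1 (cutoff (rekm1 / (8 * L)) (rekm1 / (4 * L)) dist) := by
  refine isCutoff_cutoff ?_ dist
  rw [div_lt_div_iff₀ (by positivity) (by positivity)]
  nlinarith

/-- the localized kernels (2.4)/(2.25)/(2.28) built with these cutoffs agree with the kernel within the inner
threshold and vanish beyond the outer one (`loc ζ K = ζ·K`). [cite: BalabanImbrieJaffe1988, (2.4) p.260] -/
theorem loc_cutoff_eq {R₁ R₀ : ℝ} (hR : R₁ < R₀) (dist : α → β → ℝ) (K : α → β → ℝ) (a : α) (b : β) :
    (dist a b ≤ R₁ → loc (cutoff R₁ R₀ dist) K a b = K a b) ∧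
      (R₀ ≤ dist a b → loc (cutoff R₁ R₀ dist) K a b = 0) := by
  refine ⟨fun h => ?_, fun h => ?_⟩
  · rw [loc, (isCutoff_cutoff hR dist).1 a b h, one_mul]
  · rw [loc, (isCutoff_cutoff hR dist).2 a b h, zero_mul]

/-- `|ζK| ≤ |K|` pointwise: localization never increases a kernel. [cite: BalabanImbrieJaffe1988, (2.4) p.260] -/
theorem abs_loc_cutoff_le (R₁ R₀ : ℝ) (dist : α → β → ℝ) (K : α → β → ℝ) (a : α) (b : β) :
    |loc (cutoff R₁ R₀ dist) K a b| ≤ |K a b| := by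
  rw [loc, abs_mul, abs_of_nonneg (cutoff_nonneg R₁ R₀ dist a b)]
  exact mul_le_of_le_one_left (abs_nonneg _) (cutoff_le_one R₁ R₀ dist a b)

end Literature.MathematicalPhysics.QuantumFieldTheory.BalabanImbrieJaffe1984to88.BIJ88Cutoffs21
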